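import Summits.ABC.ABC.Theses.DefiniteXi
import Summits.ABC.ABC.Theses.IsogenyGlueCongruence
import Summits.ABC.ABC.Theses.RibetTakahashiSplit
import Summits.ABC.ABC.Theorems.DefiniteXiDefiniteRTControlPrimeOfTakahashi
import Summits.ABC.ABC.Theorems.IsogenyGlueCongruenceMazurKenkuBoundOfRadius
import Summits.ABC.ABC.Theorems.IsogenyGlueCongruenceMazurKenkuBoundSplitGlue
import Summits.ABC.ABC.Theorems.IsogenyGlueCongruenceKenkuCompositeTables
import Summits.ABC.ABC.Theorems.IsogenyGlueCongruenceKenkuLevelFortyNine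
import Literature.NumberTheory.EllipticCurves.PastenSpectralDegreeIsogenyBoundProofs
import Literature.NumberTheory.EllipticCurves.ManinConstantArbitraryParametrizationIntegralProofs
import HarnessLib

/-!
# STUB-PLAN certificate, gen 2 — `stub_pasten163 : PastenShimura2024_minimalDegree_le_163_mul`
(crux stmt-ABC-11338 `DefiniteXi.DefiniteRTControlPrime`, route-ABC-DefiniteXi)

Stub-critic scratch check (planner, mode stub-critic, unit `scrit-stmt-ABC-11338-stub_pasten163-g2`).
Every load-bearing claim of STUB-PLAN-stub_pasten163.md rev 2 is a named, sorry-free theorem below, so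
ONE `lean check` (rc 0 / 0 sorries / axioms whitelist) certifies the plan:

* C0  (P0)  the crux ⇐ `stub_takahashi` ALONE, BY NAME — this stub is absent from the cone;
* C1/C1′ (door) the VERBATIM stub type IS route item stmt-ABC-15125 `IsogenyGlueCongruence.MazurKenkuBound`
       and the route-DefiniteXi copy `DefiniteXi.MazurKenkuBound` (`Iff.rfl` both);
* C2–C5 (P1) the four one-line closers a stub prover pastes under the VERBATIM header the day the
       corresponding door opens (item 15125 / fact `mazurKenku_exists_cyclic_isogeny` / item 15193 /
       IGC split children 18223 ∧ 18224, the closed children 18225, 18226 supplied BY NAME);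
* C6  (K1) the costume test (Literature `…_iff`): the stub is EQUIVALENT to the Mazur–Kenku-strength cofactor bound for every
       globally-minimal parametrised curve (`mazurKenkuBound_iff_hMK`), so no hypothesis-free short proof.
-/

set_option linter.dupNamespace false

namespace Summit.ABC.ABC.Cruxes.DefiniteRTControlPrime.StubPlanG2Pasten163

open Literature.NumberTheory.EllipticCurves Literature.NumberTheory.EllipticCurves.ModularForms
open scoped MatrixGroups ModularForm
open CongruenceSubgroup

/-- C0 (P0): the crux from `stub_takahashi` ALONE, BY NAME (landed p839521) — `stub_pasten163` unused. -/
theorem C0_crux_of_takahashi :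
    takahashi2001_thm_2_3_of_coprime → Summit.ABC.ABC.Theses.DefiniteXi.DefiniteRTControlPrime :=
  Summit.ABC.ABC.Theorems.DefiniteRTControlPrime.definiteRTControlPrime_of_takahashi

/-- C1 (door): the VERBATIM stub type IS route item stmt-ABC-15125 (IGC crux `MazurKenkuBound`). -/
theorem C1_stub_iff_item15125 :
    PastenShimura2024_minimalDegree_le_163_mul ↔
      Summit.ABC.ABC.Theses.IsogenyGlueCongruence.MazurKenkuBound :=
  Iff.rfl

/-- C1′ (door): … and IS the route-DefiniteXi copy `DefiniteXi.MazurKenkuBound` (wanted `aside`). -/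
theorem C1'_stub_iff_definiteXiCopy :
    PastenShimura2024_minimalDegree_le_163_mul ↔ Summit.ABC.ABC.Theses.DefiniteXi.MazurKenkuBound :=
  Iff.rfl

/-- C2 (P1 door a): stub from item stmt-ABC-15125 (defeq). -/
theorem C2_stub_of_item15125 (T : Summit.ABC.ABC.Theses.IsogenyGlueCongruence.MazurKenkuBound) :
    PastenShimura2024_minimalDegree_le_163_mul := T

/-- C3 (P1 door b): stub from the Literature named fact `mazurKenku_exists_cyclic_isogeny`. -/
theorem C3_stub_of_mazurKenku (hMK : mazurKenku_exists_cyclic_isogeny) :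
    PastenShimura2024_minimalDegree_le_163_mul :=
  PastenShimura2024_minimalDegree_le_163_mul_of_mazurKenku' hMK

/-- C4 (P1 door c): stub from item stmt-ABC-15193 `RibetTakahashiSplit.MazurKenkuRadius`. -/
theorem C4_stub_of_radiusItem (hRad : Summit.ABC.ABC.Theses.RibetTakahashiSplit.MazurKenkuRadius) :
    PastenShimura2024_minimalDegree_le_163_mul :=
  Summit.ABC.ABC.Theorems.mazurKenkuBound_of_radiusItem hRad

/-- C5 (P1 door d): stub from EXACTLY the two open, served IGC split children stmt-ABC-18223
`MazurCor44` and stmt-ABC-18224 `KenkuPrintedLevels`; the closed children `KenkuCompositeTables`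
(18225) and `KenkuLevelFortyNine` (18226) are supplied BY NAME from the tree. -/
theorem C5_stub_of_igcChildren (h44 : Summit.ABC.ABC.Theses.IsogenyGlueCongruence.MazurCor44)
    (hK : Summit.ABC.ABC.Theses.IsogenyGlueCongruence.KenkuPrintedLevels) :
    PastenShimura2024_minimalDegree_le_163_mul :=
  Summit.ABC.ABC.Theorems.mazurKenkuBoundGlue_proof h44 hK
    Summit.ABC.ABC.Theorems.kenkuCompositeTables_proof
    Summit.ABC.ABC.Theorems.kenkuLevelFortyNine_proof

/-- C6 (K1, costume test): the VERBATIM stub is EQUIVALENT to the Mazur–Kenku-strength statement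
"for EVERY globally-minimal parametrised `E'/ℚ` some nonzero integer multiplier `k` carries the newform
period lattice into the Néron lattice with cofactor kernel of size `≤ 163`" (tree
`PastenShimura2024_minimalDegree_le_163_mul_iff`; the same term is re-exported for the item as
`Summit.ABC.ABC.Theorems.MazurKenkuBound.Negative.mazurKenkuBound_iff_hMK`, module unbuilt on the farm
snapshot at 05:15Z, hence cited by name only). -/
theorem C6_stub_iff_hMK :
    PastenShimura2024_minimalDegree_le_163_mul ↔
      ∀ {N : ℕ} [NeZero N] {W' : WeierstrassCurve ℚ} [W'.IsElliptic] [W'.IsGloballyMinimal]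
        (D' : ModularParametrizationData W' N),
        ∃ (k : ℤ) (hk : ∀ z ∈ periodLattice D'.f, (k : ℂ) * z ∈ D'.L.lattice), k ≠ 0 ∧
          Nat.card (mulQuotientMap (periodLattice D'.f) D'.L.lattice.toAddSubgroup (k : ℂ) hk).ker
            ≤ 163 :=
  PastenShimura2024_minimalDegree_le_163_mul_iff

end Summit.ABC.ABC.Cruxes.DefiniteRTControlPrime.StubPlanG2Pasten163
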